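import Literature.NumberTheory.ComplexMultiplication.CMTypeDistinguishedElementReflexField
import HarnessLib

/-!
# The «quadratic-twist» CM type of a CM extension `M ⊇ L(√-p)` and its reflex bound `E*(Φ_M) ⊆ τ(L)(i√p)`

Topic `NumberTheory/ComplexMultiplication`; namespace `Literature.NumberTheory.ComplexMultiplication`.
Cell `hodgecm-mathlib`, fan A, binder `hDel` (crux `HDel` = stmt-HodgeConjecture-24835), line «K-TWIST» (A-p05 g3,
INBOX 2026-08-28T05:27:30Z; B-typ04 sanity-read PASS 05:28:58Z; director g2 GO P1 05:30:00Z).  ONE definition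
(`quadraticTwistCMType`, a CM type — an object the line posits) and theorems; no named fact, no instance, no notation.

## The mathematics ([Deligne1979ShimuraVarieties] 2.3.9–2.3.10 read for type `A`, our unitary datum)

Let `L` be a CM field with frame embedding `τ : L → ℂ`, and `M ⊇ L` (along `j : L → M`) a number field containing a
square root `w` of `-p` (`p > 0` a natural number), `r ∈ ℂ` a square root of `-p` in `ℂ` (e.g. `i√p`).  In the proof of
[Deligne1979ShimuraVarieties] Prop. 2.3.10 (type `A`, p. 33 of Milne's translation) the auxiliary totally imaginary
quadratic extension `K = F(√-p)` of `F = L⁺` carries a partial type `T` above the COMPACT places only, while above the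
non-compact place the complex structure comes from `L` itself («`h₃ = h_T ⊗ h₂` on `K ⊗_F V`»).  On `M = L·K` this is
ONE CM type of `M`:

  `Φ_M = {ρ : M → ℂ | ρ|_L = τ} ∪ {ρ | place(ρ|_L) ≠ place(τ), ρ(w) = r}`

(«`L`-induced above the place of `τ`, `K`-induced above the other places»).  We prove: (1) `Φ_M` IS a CM type
(`quadraticTwistCMType`); (2) it is EXT-ADAPTED: every `ρ` with `ρ ∘ j = τ` lies in `Φ_M` (`mem_quadraticTwistCMType_of_comp_eq`)
— the Hodge-type condition for the product datum `(U(H) × T₀(M), X × {h_{Φ_M}})`, exactly as `Aux.IsAdapted` (`τ ∈ Φ`)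
is for `M = L`; (3) every automorphism of `ℂ` fixing `τ(L)` and `r` stabilises `Φ_M`
(`smul_mem_quadraticTwistCMType_iff`) — NOTE that it may permute the two embeddings of `L` above a place `≠ place(τ)`,
which is what defeats the census for CM types of `L` itself ([Liu2021] Rem. C.15; tree `ReflexIntersectionObstruction`);
(4) hence, by Shimura's Prop. 28 in the tree's form (`traceField_le_iff_forall_smul_mem_iff_of_finiteDimensional`), the
REFLEX BOUND `E*(Φ_M) = traceField Φ_M ≤ τ(L) ⊔ ℚ(r)` (`traceField_quadraticTwistCMType_le`) and the compositum bound
`τ(L) ⊔ E*(Φ_M) ≤ τ(L) ⊔ ℚ(r)` (`fieldRange_sup_traceField_quadraticTwistCMType_le`): the reflex field of the twisted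
auxiliary datum is (at most) the QUADRATIC extension `τ(L)(i√p)` of `τ(L)`, so two primes give reflex composita meeting
in `τ(L)` ([Deligne1971TravauxShimura] Prop. 5.10 — row I-6 — then descends to `τ(L)`).  HC_CM is proved only modulo
the 7 printed citations until rung 0 closes; nothing here discharges a binder.

## References
* [Deligne1979ShimuraVarieties] P. Deligne, *Variétés de Shimura*, PSPM 33.2 (1979), 2.3.9–2.3.10 (proof, type A), 2.3.3
  (Milne's translation pp. 32–33).
* [Shimura1998] G. Shimura, *Abelian Varieties with Complex Multiplication and Modular Functions* (1998), §8.3 Prop. 28.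
* [Liu2021] Y. Liu, Camb. J. Math. 9 (2021), App. C Lem. C.14, Rem. C.15.
-/

set_option autoImplicit false

noncomputable section

open NumberField NumberField.ComplexEmbedding IntermediateField
open Literature.AlgebraicGeometry.Motives (CMType)

namespace Literature.NumberTheory.ComplexMultiplication

variable {L M : Type} [Field L] [NumberField L] [IsCMField L] [Field M] [NumberField M]

/-! ### §1. Square roots of `-p` -/

omit [NumberField M] in
/-- A ring homomorphism sends a square root `w` of `-p` to `±r`, `r` any square root of `-p` in `ℂ`. [folklore] -/
private theorem apply_eq_or_eq_neg_of_mul_self_eq (ρ : M →+* ℂ) {w : M} {r : ℂ} {p : ℕ}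
    (hw : w * w = -(p : M)) (hr : r * r = -(p : ℂ)) : ρ w = r ∨ ρ w = -r := by
  have h : ρ w * ρ w = r * r := by rw [← map_mul, hw, hr, map_neg, map_natCast]
  have h' : (ρ w - r) * (ρ w + r) = 0 := by linear_combination h
  rcases mul_eq_zero.1 h' with h1 | h1
  · exact Or.inl (sub_eq_zero.1 h1)
  · exact Or.inr (eq_neg_of_add_eq_zero_left h1)

/-- A square root of `-p` (`p > 0`) in `ℂ` is purely imaginary: `conj r = -r`. [folklore] -/
private theorem conj_eq_neg_of_mul_self_eq {r : ℂ} {p : ℕ} (hp : 0 < p) (hr : r * r = -(p : ℂ)) :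
    (starRingEnd ℂ) r = -r := by
  apply Complex.ext
  · simp only [Complex.conj_re, Complex.neg_re]
    have hre : (r * r).re = -(p : ℝ) := by rw [hr]; simp
    have him : (r * r).im = 0 := by rw [hr]; simp
    simp only [Complex.mul_re, Complex.mul_im] at hre him
    have him' : r.re * r.im = 0 := by nlinarith
    rcases mul_eq_zero.1 him' with h0 | h0
    · rw [h0, neg_zero]
    · exfalso
      rw [h0, mul_zero, sub_zero] at hre
      have : (0 : ℝ) < p := by exact_mod_cast hp
      nlinarith [mul_self_nonneg r.re]
  · simp only [Complex.conj_im, Complex.neg_im]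

/-- A square root of `-p` (`p > 0`) in `ℂ` is non-zero, hence `r ≠ -r`. [folklore] -/
private theorem ne_neg_self_of_mul_self_eq {r : ℂ} {p : ℕ} (hp : 0 < p) (hr : r * r = -(p : ℂ)) : r ≠ -r := by
  intro h
  have h0 : r = 0 := by
    have : r + r = 0 := by nth_rewrite 2 [h]; exact add_neg_cancel r
    simpa [← two_mul] using this
  rw [h0, zero_mul] at hr
  have : (p : ℂ) = 0 := by simpa using hr.symm
  exact (Nat.pos_iff_ne_zero.1 hp) (by exact_mod_cast this)

/-! ### §2. The twisted CM type -/

/-- The SET `Φ_M = {ρ | ρ ∘ j = τ} ∪ {ρ | place(ρ ∘ j) ≠ place(τ) ∧ ρ(w) = r}` of complex embeddings of `M`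
(«`L`-induced above the place of `τ`, `√-p ↦ r` above the other places»). [cite: Deligne1979ShimuraVarieties, 2.3.9–2.3.10] -/
def quadraticTwistSet (j : L →+* M) (τ : L →+* ℂ) (w : M) (r : ℂ) : Set (M →+* ℂ) :=
  {ρ | ρ.comp j = τ ∨ (InfinitePlace.mk (ρ.comp j) ≠ InfinitePlace.mk τ ∧ ρ w = r)}

omit [NumberField L] [IsCMField L] [NumberField M] in
/-- Membership in `Φ_M` (definitional). [cite: Deligne1979ShimuraVarieties, 2.3.9–2.3.10] -/
theorem mem_quadraticTwistSet_iff (j : L →+* M) (τ : L →+* ℂ) (w : M) (r : ℂ) (ρ : M →+* ℂ) :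
    ρ ∈ quadraticTwistSet j τ w r ↔
      ρ.comp j = τ ∨ (InfinitePlace.mk (ρ.comp j) ≠ InfinitePlace.mk τ ∧ ρ w = r) :=
  Iff.rfl

omit [NumberField M] in
/-- **`Φ_M` is a CM type of `M`**: of each pair `{ρ, ρ̄}` exactly one member lies in `Φ_M` — above the place of `τ` the
pairs are `{(τ, ±r), (τ̄, ∓r)}`, each meeting `Φ_M` in its `τ`-member; above the other places the pairs are
`{(φ, ±r), (φ̄, ∓r)}`, each meeting `Φ_M` in its `+r`-member (`L` is CM, so `τ̄ ≠ τ` and `place(φ̄) = place(φ)`;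
`ρ(w) = ±r` since `w² = -p = r²`, and `r̄ = -r ≠ r`). [cite: Deligne1979ShimuraVarieties, 2.3.9–2.3.10]
[cite: Shimura1998, §8.3 Prop. 28] -/
theorem mem_quadraticTwistSet_iff_conjugate_not_mem (j : L →+* M) (τ : L →+* ℂ) {w : M} {r : ℂ} {p : ℕ}
    (hp : 0 < p) (hw : w * w = -(p : M)) (hr : r * r = -(p : ℂ)) (ρ : M →+* ℂ) :
    ρ ∈ quadraticTwistSet j τ w r ↔ conjugate ρ ∉ quadraticTwistSet j τ w r := by
  have hτ : conjugate τ ≠ τ := fun h => IsTotallyComplex.complexEmbedding_not_isReal τ (isReal_iff.2 h)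
  have hcj : (conjugate ρ).comp j = conjugate (ρ.comp j) := conjugate_comp ρ j
  have hcw : conjugate ρ w = (starRingEnd ℂ) (ρ w) := conjugate_coe_eq ρ w
  have hrr : r ≠ -r := ne_neg_self_of_mul_self_eq hp hr
  have hconjr : (starRingEnd ℂ) r = -r := conj_eq_neg_of_mul_self_eq hp hr
  simp only [mem_quadraticTwistSet_iff, hcj, hcw, InfinitePlace.mk_conjugate_eq]
  by_cases hmk : InfinitePlace.mk (ρ.comp j) = InfinitePlace.mk τ
  · -- above the place of `τ`: `ρ ∘ j ∈ {τ, τ̄}`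
    rcases InfinitePlace.mk_eq_iff.1 hmk with h | h
    · -- `ρ ∘ j = τ`
      refine ⟨fun _ => ?_, fun _ => Or.inl h⟩
      rintro (h' | ⟨h', -⟩)
      · rw [h] at h'
        exact hτ h'
      · exact h' hmk
    · -- `ρ̄ ∘ j = τ`, i.e. `ρ ∘ j = τ̄`
      refine ⟨?_, fun h' => (h' (Or.inl h)).elim⟩
      rintro (h' | ⟨h', -⟩)
      · exact (hτ ((congrArg conjugate h'.symm).trans h)).elim
      · exact (h' hmk).elim
  · -- above another place: membership is decided by the value at `w`
    have h1 : ¬ ρ.comp j = τ := fun h => hmk (by rw [h])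
    have h2 : ¬ conjugate (ρ.comp j) = τ := fun h => hmk (by rw [← InfinitePlace.mk_conjugate_eq, h])
    simp only [h1, h2, false_or, ne_eq, hmk, not_false_eq_true, true_and]
    constructor
    · intro h h'
      rw [h, hconjr] at h'
      exact hrr h'.symm
    · intro h
      rcases apply_eq_or_eq_neg_of_mul_self_eq ρ hw hr with h' | h'
      · exact h'
      · exact (h (by rw [h', map_neg, hconjr, neg_neg])).elim

/-- **The quadratic-twist CM type `Φ_M` of `M ⊇ L(√-p)`** relative to the frame `τ` of `L`, the square root `w ∈ M` of
`-p` and the square root `r ∈ ℂ` of `-p`. [cite: Deligne1979ShimuraVarieties, 2.3.9–2.3.10 (proof, type A)] -/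
def quadraticTwistCMType (j : L →+* M) (τ : L →+* ℂ) {w : M} {r : ℂ} {p : ℕ}
    (hp : 0 < p) (hw : w * w = -(p : M)) (hr : r * r = -(p : ℂ)) : CMType M :=
  ⟨quadraticTwistSet j τ w r, mem_quadraticTwistSet_iff_conjugate_not_mem j τ hp hw hr⟩

omit [NumberField M] in
/-- The underlying set of `quadraticTwistCMType` (definitional). [cite: Deligne1979ShimuraVarieties, 2.3.9–2.3.10] -/
@[simp] theorem coe_quadraticTwistCMType (j : L →+* M) (τ : L →+* ℂ) {w : M} {r : ℂ} {p : ℕ}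
    (hp : 0 < p) (hw : w * w = -(p : M)) (hr : r * r = -(p : ℂ)) :
    (quadraticTwistCMType j τ hp hw hr).1 = quadraticTwistSet j τ w r := rfl

omit [NumberField M] in
/-- **`Φ_M` is ext-adapted**: every embedding of `M` extending `τ` lies in `Φ_M` — the Hodge-type condition of the twisted
auxiliary datum `(U(H) × T₀(M), X × {h_{Φ_M}})` (both embeddings of `M` above `τ` give the scalar `z` on `V_τ`, so `W⁺ ↦ z`,
`ℓ ↦ z̄`). [cite: Deligne1979ShimuraVarieties, 2.3.10 (proof: «`h₃` is of type `{(-1,0),(0,-1)}`») and 2.3.1] -/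
theorem mem_quadraticTwistCMType_of_comp_eq (j : L →+* M) (τ : L →+* ℂ) {w : M} {r : ℂ} {p : ℕ}
    (hp : 0 < p) (hw : w * w = -(p : M)) (hr : r * r = -(p : ℂ)) {ρ : M →+* ℂ} (h : ρ.comp j = τ) :
    ρ ∈ (quadraticTwistCMType j τ hp hw hr).1 :=
  Or.inl h

/-! ### §3. The stabiliser and the reflex bound -/

omit [NumberField M] in
/-- **Every automorphism of `ℂ` fixing `τ(L)` pointwise and fixing `r` stabilises `Φ_M`** — it may still permute the two
embeddings of `L` above a place other than that of `τ`; `Φ_M` contains both of their `+r`-lifts, so it does not matter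
(contrast: a CM type OF `L` must choose one of them, [Liu2021] Rem. C.15). [cite: Deligne1979ShimuraVarieties, 2.3.10 (i)]
[cite: Shimura1998, §8.3 Prop. 28] -/
theorem smul_mem_quadraticTwistSet_iff (j : L →+* M) (τ : L →+* ℂ) (w : M) (r : ℂ) (γ : ℂ ≃+* ℂ)
    (hγ : ∀ x : L, γ (τ x) = τ x) (hγr : γ r = r) (ρ : M →+* ℂ) :
    γ • ρ ∈ quadraticTwistSet j τ w r ↔ ρ ∈ quadraticTwistSet j τ w r := by
  -- `γ` fixes `τ` and `τ̄` (same image `τ(L)`, `L` being CM)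
  have hfixτ : γ.toRingHom.comp τ = τ := RingHom.ext fun x => hγ x
  have hfixτ' : γ.toRingHom.comp (conjugate τ) = conjugate τ := RingHom.ext fun x => by
    change γ (conjugate τ x) = conjugate τ x
    rw [conjugate_coe_eq, ← IsCMField.complexEmbedding_complexConj (K := L) τ x, hγ]
  have hfix : ∀ ψ : L →+* ℂ, (ψ = τ ∨ ψ = conjugate τ) → γ.toRingHom.comp ψ = ψ := by
    rintro ψ (rfl | rfl)
    exacts [hfixτ, hfixτ']
  have hcomp : (γ • ρ).comp j = γ.toRingHom.comp (ρ.comp j) := rfl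
  -- cancelling `γ` against `τ`, `τ̄`
  have key : ∀ ψ : L →+* ℂ, (ψ = τ ∨ ψ = conjugate τ) →
      (ψ = γ.toRingHom.comp (ρ.comp j) ↔ ψ = ρ.comp j) := by
    intro ψ hψ
    constructor
    · intro h
      have h' : γ.toRingHom.comp ψ = γ.toRingHom.comp (ρ.comp j) := by rw [hfix ψ hψ]; exact h
      exact RingHom.ext fun x => γ.injective (by simpa using congrArg (fun f => f x) h')
    · intro h
      rw [← hfix ψ hψ, h]
  -- the three membership data are `γ`-invariant
  have h1 : (γ • ρ).comp j = τ ↔ ρ.comp j = τ := by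
    rw [hcomp, eq_comm, key τ (Or.inl rfl), eq_comm]
  have h2 : InfinitePlace.mk ((γ • ρ).comp j) = InfinitePlace.mk τ ↔
      InfinitePlace.mk (ρ.comp j) = InfinitePlace.mk τ := by
    rw [hcomp]
    conv_lhs => rw [eq_comm, InfinitePlace.mk_eq_iff]
    conv_rhs => rw [eq_comm, InfinitePlace.mk_eq_iff]
    rw [key τ (Or.inl rfl), key (conjugate τ) (Or.inr rfl)]
  have h3 : (γ • ρ) w = r ↔ ρ w = r := by
    rw [ringEquiv_smul_apply]
    constructor
    · intro h
      exact γ.injective (h.trans hγr.symm)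
    · intro h
      rw [h, hγr]
  simp only [mem_quadraticTwistSet_iff, ne_eq, h1, h2, h3]

/-- **Reflex bound `E*(Φ_M) ⊆ τ(L)(r)`**: the trace field (reflex field) of the quadratic-twist CM type is contained in the
compositum `τ(L) ⊔ ℚ(r)` — by Shimura's Prop. 28 (`traceField ≤ M' ⟺ Aut(ℂ/M')` stabilises the type, tree
`traceField_le_iff_forall_smul_mem_iff_of_finiteDimensional`) and `smul_mem_quadraticTwistSet_iff`.
[cite: Shimura1998, §8.3 Prop. 28] [cite: Deligne1979ShimuraVarieties, 2.3.10 (i) («`E(G₁,X₁) = E(G,X)·E(K,h_T)`»)] -/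
theorem traceField_quadraticTwistCMType_le (j : L →+* M) (τ : L →+* ℂ) {w : M} {r : ℂ} {p : ℕ}
    (hp : 0 < p) (hw : w * w = -(p : M)) (hr : r * r = -(p : ℂ)) :
    traceField (quadraticTwistCMType j τ hp hw hr) ≤ τ.toRatAlgHom.fieldRange ⊔ IntermediateField.adjoin ℚ {r} := by
  haveI : FiniteDimensional ℚ ↥τ.toRatAlgHom.fieldRange :=
    LinearEquiv.finiteDimensional (AlgEquiv.ofInjectiveField τ.toRatAlgHom).toLinearEquiv
  have hri : IsIntegral ℚ r := by
    refine ⟨Polynomial.X ^ 2 + Polynomial.C (p : ℚ), Polynomial.monic_X_pow_add_C _ two_ne_zero, ?_⟩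
    simp [sq, hr]
  haveI : FiniteDimensional ℚ ↥(IntermediateField.adjoin ℚ {r}) := IntermediateField.adjoin.finiteDimensional hri
  haveI : FiniteDimensional ℚ ↥(τ.toRatAlgHom.fieldRange ⊔ IntermediateField.adjoin ℚ {r}) :=
    IntermediateField.finiteDimensional_sup _ _
  rw [traceField_le_iff_forall_smul_mem_iff_of_finiteDimensional]
  intro γ hγ χ
  refine smul_mem_quadraticTwistSet_iff j τ w r γ (fun x => hγ _ ?_) (hγ _ ?_) χ
  · exact (le_sup_left : τ.toRatAlgHom.fieldRange ≤ _) (AlgHom.mem_fieldRange.2 ⟨x, rfl⟩)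
  · exact (le_sup_right : IntermediateField.adjoin ℚ {r} ≤ _) (IntermediateField.mem_adjoin_simple_self ℚ r)

/-- **The reflex field of the twisted auxiliary datum is at most `τ(L)(r)`**: `τ(L) ⊔ E*(Φ_M) ≤ τ(L) ⊔ ℚ(r)` — the base field of
the canonical model of `Sh(U(H) × T₀(M), X × {h_{Φ_M}})` ([Deligne1979ShimuraVarieties] 2.3.1, reflex of a product = compositum)
lies in the quadratic extension `τ(L)(i√p)` of `τ(L)`. [cite: Deligne1979ShimuraVarieties, 2.3.10 (i)] [cite: Shimura1998, §8.3 Prop. 28] -/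
theorem fieldRange_sup_traceField_quadraticTwistCMType_le (j : L →+* M) (τ : L →+* ℂ) {w : M} {r : ℂ} {p : ℕ}
    (hp : 0 < p) (hw : w * w = -(p : M)) (hr : r * r = -(p : ℂ)) :
    τ.toRatAlgHom.fieldRange ⊔ traceField (quadraticTwistCMType j τ hp hw hr) ≤
      τ.toRatAlgHom.fieldRange ⊔ IntermediateField.adjoin ℚ {r} :=
  sup_le le_sup_left (traceField_quadraticTwistCMType_le j τ hp hw hr)

end Literature.NumberTheory.ComplexMultiplication

end
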